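import Summits.AtomisticToContinuum.FouriersLaw.Theses.CageBudgetFekete

/-!
# `CageBudgetFekete.UnboundedHeatVariance` / Negative (2): the abstract cage —
# what a counterexample must look like, and why the route's frame cannot prove U

Support file (`--supports stmt-AtomisticToContinuum-15771`) of the crux disprover of
`Summit.AtomisticToContinuum.FouriersLaw.Theses.CageBudgetFekete.UnboundedHeatVariance` (U: in the guarded
arena of route CageBudgetFekete the equilibrium heat variance `V(τ) = 2∫₀^τ (τ-s) C(s) ds` of the infinite
pinned quartic chain is unbounded). The crux is NOT refuted: it is the positivity half of Fourier's law for the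
clean chain (open problem), and no insulating `(μ, D)` of `pinnedChain` is constructible (Negative (1),
`LoadBearing.lean`, shows the two junk-excluding hypotheses are load-bearing). This file lands the ABSTRACT
side of the disproof analysis, in the spectral vocabulary of the picked line `birth`
(`Cruxes/UnboundedHeatVariance/Lines/birth.lean`, stubs S1–S3):

* `integral_Ioc_sub_mul_cos`, `integral_Ioc_sub_mul_cos_zero` — the heat-variance kernel in closed form:
  `∫_{(0,τ]} (τ-s) cos(ωs) ds = (1 - cos ωτ)/ω²` (`ω ≠ 0`), `= τ²/2` (`ω = 0`).
* `spectralHeatVariance_fubini` — for every FINITE measure `ρ` on `ℝ` and every `τ`,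
  `2∫_{(0,τ]} (τ-s)(∫cos(ωs)dρ) ds = ∫ (2∫_{(0,τ]} (τ-s)cos(ωs) ds) dρ` (Fubini; the first half of S3;
  mind the parentheses: in `∫ w, 2 * ∫ s in S, f ∂ρ` Lean attaches `∂ρ` to the INNER integral).
* `spectralHeatVariance_le_of_integrable_inv_sq` — **the abstract insulator (exact converse of S3).** If `ρ`
  has no atom at `0` and `ω ↦ (ω²)⁻¹` is `ρ`-integrable, the spectral heat variance is CAGED:
  `2∫_{(0,τ]} (τ-s)(∫cos(ωs)dρ) ds ≤ 4∫(ω²)⁻¹dρ` for every `τ`. Hence S3's infrared hypothesis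
  `0 < ρ{0} ∨ ¬Integrable (ω ↦ (ω²)⁻¹) ρ` is NECESSARY as well as sufficient, S2 of `birth` is exactly what U
  needs of the current spectral measure, and any counterexample to U must be a guarded `(μ, D)` whose current
  class is an `ℋ₀`-coboundary `[J] = L u` (`‖u‖² = ∫ ω⁻² dρ < ∞`, no Drude atom).
* `spectralHeatVariance_dirac_one`, `stub_spectralHeatVarianceUnbounded_false_without_infrared` — the
  one-line instance `ρ = δ₁` (`C = cos`, `V(τ) = 2(1 - cos τ) ≤ 4`): S3 with its infrared hypothesis deleted
  is FALSE.
* `stub_spectralHeatVarianceUnbounded_false_without_finite` — S3 with `IsFiniteMeasure ρ` deleted is FALSE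
  (junk witness `ρ = ∞ • δ₁`: every Bochner integral against it is `0`, while `(ω²)⁻¹` is not integrable).
* `not_unboundedHeatVariance_of_abstract_frame` — **the frame cannot prove U.** The natural abstract
  strengthening "every continuous, even kernel `C` of positive type (cosine transform of a finite measure) with
  `C(0) > 0`, `|C| ≤ C(0)`, non-negative heat variance, a CAGE BUDGET (crux Q: `V(s)+V(t) ≤ V(s+t)+K`) and a
  LINEAR CEILING (crux C) has unbounded heat variance" is FALSE: `C = cos` satisfies all of it with `K = 8`,
  `B = 1`, and `V ≤ 4`. So U is independent of the route's other cruxes Q, C and of everything the calculus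
  crux `HeatVarianceCalculus` records (its Laplace identity and integrability clauses are formal consequences
  of `V'' = 2C`, `V(0) = V'(0) = 0` for bounded continuous `C`); a proof of U must use an input that is
  specific to the chain's dynamics at zero frequency (no spectral gap of `[J]` in the `∫ω⁻²dρ` sense).

No new definitions (weakened statements spelled inline). refuter-cdisprove-stmt-AtomisticToContinuum-15771-0,
2026-08-17.
-/

noncomputable section

namespace Summit.AtomisticToContinuum.FouriersLaw.Theorems.UnboundedHeatVariance.Negative

open MeasureTheory Set Filter Topology
open scoped ENNReal

/-! ## §1 The heat-variance kernel in closed form -/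

/-- `∫_{(0,τ]} (τ - s) cos(ω s) ds = (1 - cos ωτ)/ω²` for `ω ≠ 0`, `τ ≥ 0` (primitive
`(τ-s) sin(ωs)/ω - cos(ωs)/ω²`). [folklore] -/
theorem integral_Ioc_sub_mul_cos {w : ℝ} (hw : w ≠ 0) {τ : ℝ} (hτ : 0 ≤ τ) :
    ∫ s in Ioc (0:ℝ) τ, (τ - s) * Real.cos (w * s) = (1 - Real.cos (w * τ)) / w ^ 2 := by
  rw [← intervalIntegral.integral_of_le hτ]
  have hF : ∀ s ∈ uIcc 0 τ, HasDerivAt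
      (fun s => (τ - s) * Real.sin (w * s) / w - Real.cos (w * s) / w ^ 2)
      ((τ - s) * Real.cos (w * s)) s := by
    intro s _
    have h1 : HasDerivAt (fun s => w * s) w s := by
      simpa using (hasDerivAt_id s).const_mul w
    have hsin : HasDerivAt (fun s => Real.sin (w * s)) (Real.cos (w * s) * w) s :=
      (Real.hasDerivAt_sin _).comp s h1
    have hcos : HasDerivAt (fun s => Real.cos (w * s)) (-Real.sin (w * s) * w) s :=
      (Real.hasDerivAt_cos _).comp s h1
    have hlin : HasDerivAt (fun s => τ - s) (-1) s := by
      simpa using (hasDerivAt_id s).const_sub τ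
    refine (((hlin.mul hsin).div_const w).sub (hcos.div_const (w ^ 2))).congr_deriv ?_
    field_simp
    ring
  rw [intervalIntegral.integral_eq_sub_of_hasDerivAt hF
    ((by fun_prop : Continuous fun s => (τ - s) * Real.cos (w * s)).intervalIntegrable _ _)]
  simp only [mul_zero, Real.sin_zero, Real.cos_zero, sub_self, zero_mul, zero_div, zero_sub]
  field_simp
  ring

/-- `∫_{(0,τ]} (τ - s) cos(0·s) ds = τ²/2` for `τ ≥ 0` (the Drude-atom value of the kernel). [folklore] -/
theorem integral_Ioc_sub_mul_cos_zero {τ : ℝ} (hτ : 0 ≤ τ) :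
    ∫ s in Ioc (0:ℝ) τ, (τ - s) * Real.cos (0 * s) = τ ^ 2 / 2 := by
  simp only [zero_mul, Real.cos_zero, mul_one]
  rw [← intervalIntegral.integral_of_le hτ, intervalIntegral.integral_sub intervalIntegrable_const
    intervalIntegral.intervalIntegrable_id, intervalIntegral.integral_const, integral_id]
  simp
  ring

/-! ## §2 Fubini: the spectral heat variance is the `ρ`-integral of the kernel -/

/-- For a finite measure `ρ` on `ℝ`: `2∫_{(0,τ]} (τ-s)(∫cos(ωs)dρ(ω)) ds = ∫ 2∫_{(0,τ]}(τ-s)cos(ωs)ds dρ(ω)`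
(the integrand `(s, ω) ↦ (τ-s)cos(ωs)` is continuous and bounded by `|τ-s|` on the finite measure space
`Leb|_{(0,τ]} ⊗ ρ`). [folklore] -/
theorem spectralHeatVariance_fubini (ρ : Measure ℝ) [IsFiniteMeasure ρ] (τ : ℝ) :
    2 * ∫ s in Ioc (0:ℝ) τ, (τ - s) * ∫ w, Real.cos (w * s) ∂ρ
      = ∫ w, (2 * ∫ s in Ioc (0:ℝ) τ, (τ - s) * Real.cos (w * s)) ∂ρ := by
  have hInt : Integrable (Function.uncurry fun s w : ℝ => (τ - s) * Real.cos (w * s))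
      ((volume.restrict (Ioc (0:ℝ) τ)).prod ρ) := by
    have h1 : Integrable (fun s : ℝ => ‖τ - s‖) (volume.restrict (Ioc (0:ℝ) τ)) :=
      (by fun_prop : Continuous fun s : ℝ => ‖τ - s‖).integrableOn_Ioc
    have h2 : Integrable (fun _ : ℝ => (1:ℝ)) ρ := integrable_const 1
    refine (h1.mul_prod h2).mono' ?_ (Eventually.of_forall fun z => ?_)
    · exact (by fun_prop : Continuous fun z : ℝ × ℝ => (τ - z.1) * Real.cos (z.2 * z.1)).aestronglyMeasurable
    · change ‖(τ - z.1) * Real.cos (z.2 * z.1)‖ ≤ ‖τ - z.1‖ * 1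
      rw [norm_mul, mul_one]
      exact mul_le_of_le_one_right (norm_nonneg _) (by simpa using Real.abs_cos_le_one (z.2 * z.1))
  have hswap : ∫ s in Ioc (0:ℝ) τ, (∫ w, (τ - s) * Real.cos (w * s) ∂ρ)
      = ∫ w, (∫ s in Ioc (0:ℝ) τ, (τ - s) * Real.cos (w * s)) ∂ρ :=
    integral_integral_swap hInt
  calc 2 * ∫ s in Ioc (0:ℝ) τ, (τ - s) * ∫ w, Real.cos (w * s) ∂ρ
      = 2 * ∫ s in Ioc (0:ℝ) τ, (∫ w, (τ - s) * Real.cos (w * s) ∂ρ) := by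
        congr 1
        refine integral_congr_ae (Eventually.of_forall fun s => ?_)
        exact (integral_const_mul _ _).symm
    _ = 2 * ∫ w, (∫ s in Ioc (0:ℝ) τ, (τ - s) * Real.cos (w * s)) ∂ρ := by rw [hswap]
    _ = ∫ w, (2 * ∫ s in Ioc (0:ℝ) τ, (τ - s) * Real.cos (w * s)) ∂ρ := (integral_const_mul _ _).symm

/-! ## §3 The abstract insulator: exact converse of `birth` S3 (tightness) -/

/-- **Abstract insulator criterion (converse of S3 `stub_spectralHeatVarianceUnbounded`).** If the finite
measure `ρ` has no atom at `0` and `ω ↦ (ω²)⁻¹` is `ρ`-integrable, then the spectral heat variance is caged: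
`2∫_{(0,τ]} (τ-s)(∫cos(ωs)dρ) ds ≤ 4∫(ω²)⁻¹dρ` for every `τ` (pointwise `2(1 - cos ωτ)/ω² ≤ 4/ω²`). So S3's
infrared alternative `0 < ρ{0} ∨ ¬Integrable (ω ↦ (ω²)⁻¹) ρ` is necessary, and a counterexample to U is
exactly a guarded pair whose current spectral measure is of this insulating type (`[J]` an exact
`ℋ₀`-coboundary). [folklore; von Neumann coboundary dichotomy in spectral form] -/
theorem spectralHeatVariance_le_of_integrable_inv_sq (ρ : Measure ℝ) [IsFiniteMeasure ρ]
    (h0 : ρ {0} = 0) (hint : Integrable (fun w : ℝ => (w ^ 2)⁻¹) ρ) (τ : ℝ) :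
    2 * ∫ s in Ioc (0:ℝ) τ, (τ - s) * ∫ w, Real.cos (w * s) ∂ρ ≤ 4 * ∫ w, (w ^ 2)⁻¹ ∂ρ := by
  rcases lt_or_ge τ 0 with hτ | hτ
  · rw [Ioc_eq_empty (not_lt.2 hτ.le), Measure.restrict_empty, integral_zero_measure, mul_zero]
    exact mul_nonneg (by norm_num) (integral_nonneg fun w => by positivity)
  rw [spectralHeatVariance_fubini, show (4:ℝ) * ∫ w, (w ^ 2)⁻¹ ∂ρ = ∫ w, 4 * (w ^ 2)⁻¹ ∂ρ from
    (integral_const_mul _ _).symm]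
  have hae : ∀ᵐ w ∂ρ, w ≠ 0 := by
    filter_upwards [measure_eq_zero_iff_ae_notMem.1 h0] with w hw
    simpa using hw
  have hEq : (fun w : ℝ => 2 * ∫ s in Ioc (0:ℝ) τ, (τ - s) * Real.cos (w * s))
      =ᵐ[ρ] fun w => 2 * ((1 - Real.cos (w * τ)) / w ^ 2) := by
    filter_upwards [hae] with w hw
    rw [integral_Ioc_sub_mul_cos hw hτ]
  rw [integral_congr_ae hEq]
  refine integral_mono_of_nonneg (Eventually.of_forall fun w => ?_) (hint.const_mul 4)
    (Eventually.of_forall fun w => ?_)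
  · have : 0 ≤ 1 - Real.cos (w * τ) := sub_nonneg.2 (Real.cos_le_one _)
    positivity
  · show 2 * ((1 - Real.cos (w * τ)) / w ^ 2) ≤ 4 * (w ^ 2)⁻¹
    rw [div_eq_mul_inv]
    have h1 : 1 - Real.cos (w * τ) ≤ 2 := by linarith [Real.neg_one_le_cos (w * τ)]
    have h2 : (0:ℝ) ≤ (w ^ 2)⁻¹ := by positivity
    nlinarith

/-! ## §4 The one-line cage `ρ = δ₁` (`C = cos`) -/

/-- For `ρ = δ₁` the kernel is `C = cos` and the spectral heat variance is `V(τ) = 2(1 - cos τ)` (`τ ≥ 0`).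
[folklore] -/
theorem spectralHeatVariance_dirac_one {τ : ℝ} (hτ : 0 ≤ τ) :
    2 * ∫ s in Ioc (0:ℝ) τ, (τ - s) * ∫ w, Real.cos (w * s) ∂(Measure.dirac (1:ℝ))
      = 2 * (1 - Real.cos τ) := by
  simp_rw [integral_dirac]
  rw [integral_Ioc_sub_mul_cos one_ne_zero hτ]
  simp

/-- **S3 without its infrared hypothesis is false** (`birth` stub `stub_spectralHeatVarianceUnbounded` with
the clause `0 < ρ{0} ∨ ¬Integrable (ω ↦ (ω²)⁻¹) ρ` deleted): `ρ = δ₁` is finite and its spectral heat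
variance `2(1 - cos τ)` never exceeds `R = 4`. [folklore] -/
theorem stub_spectralHeatVarianceUnbounded_false_without_infrared :
    ¬ (∀ ρ : MeasureTheory.Measure ℝ, MeasureTheory.IsFiniteMeasure ρ → ∀ R : ℝ, ∃ τ : ℝ, 0 ≤ τ ∧
        R < 2 * ∫ s in Set.Ioc (0:ℝ) τ, (τ - s) * (∫ w : ℝ, Real.cos (w * s) ∂ρ)) := by
  intro h
  obtain ⟨τ, hτ, hR⟩ := h (Measure.dirac 1) inferInstance 4
  rw [spectralHeatVariance_dirac_one hτ] at hR
  linarith [Real.neg_one_le_cos τ]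

/-- **S3 without `IsFiniteMeasure ρ` is false** (junk-excluding hypothesis): for `ρ = ∞ • δ₁` every Bochner
integral `∫ cos(ωs) dρ` is the junk value `0` (so the spectral heat variance vanishes identically), while
`ρ{0} = 0`-or-not is irrelevant because `ω ↦ (ω²)⁻¹` has infinite lower integral, i.e. is not integrable.
[folklore] -/
theorem stub_spectralHeatVarianceUnbounded_false_without_finite :
    ¬ (∀ ρ : MeasureTheory.Measure ℝ, (0 < ρ {0} ∨ ¬ MeasureTheory.Integrable (fun w : ℝ => (w ^ 2)⁻¹) ρ) →
        ∀ R : ℝ, ∃ τ : ℝ, 0 ≤ τ ∧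
          R < 2 * ∫ s in Set.Ioc (0:ℝ) τ, (τ - s) * (∫ w : ℝ, Real.cos (w * s) ∂ρ)) := by
  intro h
  set ρ : Measure ℝ := (∞ : ℝ≥0∞) • Measure.dirac (1:ℝ) with hρ
  have hnot : ¬ Integrable (fun w : ℝ => (w ^ 2)⁻¹) ρ := by
    intro hi
    have hfin := hi.hasFiniteIntegral
    rw [hasFiniteIntegral_iff_enorm, hρ, lintegral_smul_measure, lintegral_dirac] at hfin
    simp at hfin
  obtain ⟨τ, -, hR⟩ := h ρ (Or.inr hnot) 0
  have hzero : ∀ s : ℝ, ∫ w : ℝ, Real.cos (w * s) ∂ρ = 0 := fun s => by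
    rw [hρ, integral_smul_measure, ENNReal.toReal_top, zero_smul]
  simp only [hzero, mul_zero, integral_zero] at hR
  exact lt_irrefl _ hR

/-! ## §5 The route's frame cannot prove U -/

/-- **The abstract frame does not imply U.** FALSE: "every continuous even kernel `C` with `C(0) > 0`,
`|C| ≤ C(0)`, of positive type (cosine transform of a finite measure), whose heat variance
`V(τ) = 2∫_{(0,τ]}(τ-s)C(s)ds` is non-negative, quasi-superadditive with a cage budget (the route's crux Q) and
under a linear ceiling (the route's crux C), has `sup_τ V = ∞`". Witness `C = cos` (`ρ = δ₁`):
`V(τ) = 2(1 - cos τ) ∈ [0, 4]`, `K = 8`, `B = 1`, `τ₁ = 4`, and `R = 4` is never exceeded. Hence U is not a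
consequence of Q, C, `HeatVarianceCalculus` and Bochner positivity together: its proof needs a zero-frequency
input specific to the chain. [folklore] -/
theorem not_unboundedHeatVariance_of_abstract_frame :
    ¬ (∀ C : ℝ → ℝ, Continuous C → 0 < C 0 → (∀ t : ℝ, |C t| ≤ C 0) → (∀ t : ℝ, C (-t) = C t) →
        (∃ ρ : MeasureTheory.Measure ℝ, MeasureTheory.IsFiniteMeasure ρ ∧
          ∀ t : ℝ, C t = ∫ w : ℝ, Real.cos (w * t) ∂ρ) →
        ∀ V : ℝ → ℝ, V = (fun τ : ℝ => 2 * ∫ s in Set.Ioc (0:ℝ) τ, (τ - s) * C s) →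
          (∀ τ : ℝ, 0 ≤ τ → 0 ≤ V τ) →
          (∃ K : ℝ, 0 ≤ K ∧ ∀ s t : ℝ, 0 ≤ s → 0 ≤ t → V s + V t ≤ V (s + t) + K) →
          (∃ B τ₁ : ℝ, ∀ τ : ℝ, τ₁ ≤ τ → V τ ≤ B * τ) →
          ∀ R : ℝ, ∃ τ : ℝ, 0 ≤ τ ∧ R < V τ) := by
  intro h
  set V : ℝ → ℝ := fun τ => 2 * ∫ s in Set.Ioc (0:ℝ) τ, (τ - s) * Real.cos s with hV
  have hVpos : ∀ τ : ℝ, 0 ≤ τ → V τ = 2 * (1 - Real.cos τ) := fun τ hτ => by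
    have h1 := integral_Ioc_sub_mul_cos one_ne_zero hτ
    simp only [one_mul, one_pow, div_one] at h1
    simp only [hV, h1]
  have hVneg : ∀ τ : ℝ, τ < 0 → V τ = 0 := fun τ hτ => by
    simp only [hV, Ioc_eq_empty (not_lt.2 hτ.le), Measure.restrict_empty, integral_zero_measure, mul_zero]
  have hVle : ∀ τ : ℝ, V τ ≤ 4 := fun τ => by
    rcases lt_or_ge τ 0 with hτ | hτ
    · rw [hVneg τ hτ]; norm_num
    · rw [hVpos τ hτ]; linarith [Real.neg_one_le_cos τ]
  have hV0 : ∀ τ : ℝ, 0 ≤ V τ := fun τ => by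
    rcases lt_or_ge τ 0 with hτ | hτ
    · rw [hVneg τ hτ]
    · rw [hVpos τ hτ]; linarith [Real.cos_le_one τ]
  obtain ⟨τ, -, hτ⟩ := h Real.cos Real.continuous_cos (by rw [Real.cos_zero]; norm_num)
    (fun t => by rw [Real.cos_zero]; exact Real.abs_cos_le_one t) (fun t => Real.cos_neg t)
    ⟨Measure.dirac 1, inferInstance, fun t => by rw [integral_dirac, one_mul]⟩
    V hV (fun τ _ => hV0 τ)
    ⟨8, by norm_num, fun s t _ _ => by linarith [hVle s, hVle t, hV0 (s + t)]⟩
    ⟨1, 4, fun τ hτ4 => by linarith [hVle τ]⟩ 4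
  linarith [hVle τ]

end Summit.AtomisticToContinuum.FouriersLaw.Theorems.UnboundedHeatVariance.Negative

end
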